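import Literature.Computability.Complexity.ExtMonotoneCircuits
import Literature.Computability.Complexity.ExtMonotoneGRankSupport
import Literature.Computability.Complexity.MonotoneSwitching
import Literature.Computability.Complexity.CliqueTestGraphs
import Literature.Computability.Complexity.CliqueCounting
import Literature.Computability.Complexity.ExtMonotoneCliqueGate
import Summits.PneNP.PneNP.Theorems.ConvexRankGatesCliqueExtLowerBoundStubNarrowAlgebraicHelpers
import Mathlib

/-!
# Stub `stub_narrowAlgebraic` of line `width-threshold-certificate-sparsity` (crux `CliqueExtLowerBound`, stmt-PneNP-10682)

NARROW ALGEBRAIC GATES: PERM/GRANK gates of width ≤ ⌊m^{1/16}⌋ are sandwichable in the worst case (short minterms; switch up once and down once).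

Proof. A PERM/GRANK gate `φ` of width `≤ T = ⌊m^{1/16}⌋₊` is monotone and every accepted input
dominates an accepted indicator of at most `T (log₂ T + 1)` on-positions (helpers file, from
the tree's `GateLocality`: strict subgroup chains in `Sym (Fin d)` / one monomial of a `θ × θ`
minor). Fed with `(r-1)`-DNFs
`D j`, `x ↦ φ (D(x))` is therefore an `ℓ`-DNF `A₀` over the edges, `ℓ = T (log₂ T + 1) (r - 1)`
(`exists_bigDNF`). Switch it up once (`monotoneSwitching_dnf`: an `(s-1)`-CNF `B ≥ A₀` and `≤ ℓ^s`
exact `s`-clauses `Cf` with `B ∧ Cf ≤ A₀`) and down once (`monotoneSwitching_cnf`: an `(r-1)`-DNF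
`A ≤ B` and `≤ (s-1)^r` exact `r`-monomials `Df` with `B ≤ A ∨ Df`); output `(A, B)`. A positive
(clique vector of a `k`-set, `k = ⌈m^{1/4}⌉₊`) accepted by `φ ∘ D` but not by `A` satisfies a member
of `Df`, which spans `≥ 4 (c + 3)` vertices: mass `≤ (s-1)^r (k/m)^{4(c+3)} ≤ 1 / (8 m^{c+1})`.
A negative (complement of a `t`-set of edge slots, `t = #slots / ⌊m^{1/8}⌋₊`) accepted by `B` but
rejected by `φ ∘ C` falsifies a clause of `Cf` (else `A₀`, hence `φ ∘ D ≤ φ ∘ C`, accepts): mass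
`≤ ℓ^s ⌊m^{1/8}⌋₊^{-s} ≤ 1 / (8 m^{c+1})` for `s ≥ 16 (c + 3)` (mass lemmas and numerics in the
helpers file).
-/

set_option linter.dupNamespace false

open Literature.Computability.Complexity Filter Finset

namespace Summit.PneNP.PneNP.Theorems.CliqueExtLowerBound.WidthThreshold.NarrowAlgebraic

open Summit.PneNP.PneNP.Theorems.CliqueExtLowerBound.WidthThreshold.NarrowAlgebraicHelpers

/-- Union bound in product form: if `bad ⊆ ⋃_{b ∈ F} piece b` and `#(piece b) · W ≤ total` for
every `b ∈ F`, then `#bad · W ≤ #F · total`. [folklore] -/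
theorem card_mul_le_of_subset_biUnion {α β : Type*} [DecidableEq α] (bad : Finset α)
    (F : Finset β) (piece : β → Finset α) (hsub : bad ⊆ F.biUnion piece) {W total : ℕ}
    (hpiece : ∀ b ∈ F, #(piece b) * W ≤ total) : #bad * W ≤ #F * total :=
  calc #bad * W ≤ #(F.biUnion piece) * W := Nat.mul_le_mul_right _ (Finset.card_le_card hsub)
    _ ≤ (∑ b ∈ F, #(piece b)) * W := Nat.mul_le_mul_right _ Finset.card_biUnion_le
    _ = ∑ b ∈ F, #(piece b) * W := Finset.sum_mul _ _ _
    _ ≤ ∑ _b ∈ F, total := Finset.sum_le_sum hpiece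
    _ = #F * total := by rw [Finset.sum_const, smul_eq_mul]

/-- **The big DNF.** Let `f` be a monotone gate on `n` wires such that every accepted input
dominates an accepted indicator of at most `L` on-positions, and feed wire `j` with the DNF `D j`
whose monomials have at most `w` variables. Then `x ↦ f (D₁(x), …, Dₙ(x))` is a DNF whose
monomials have at most `L * w` variables: the unions `⋃_{j ∈ S} R_j` over accepted indicators `S`,
`#S ≤ L`, and choices `R_j ∈ D j`. [folklore] -/
theorem exists_bigDNF {ι : Type*} [DecidableEq ι] {n : ℕ} (f : (Fin n → Bool) → Bool)
    (hf : Monotone f) (L w : ℕ)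
    (hcover : ∀ v, f v = true → ∃ S : Finset (Fin n), #S ≤ L ∧ (∀ i ∈ S, v i = true) ∧
      f (fun i => decide (i ∈ S)) = true)
    (D : Fin n → Finset (Finset ι)) (hD : ∀ j, ∀ R ∈ D j, #R ≤ w)
    [∀ j x, Decidable (EvalDNF (D j) x)] :
    ∃ A : Finset (Finset ι), (∀ R ∈ A, #R ≤ L * w) ∧
      ∀ x, EvalDNF A x ↔ f (fun j => decide (EvalDNF (D j) x)) = true := by
  refine ⟨(univ.filter fun S : Finset (Fin n) =>
      #S ≤ L ∧ f (fun i => decide (i ∈ S)) = true).biUnion fun S =>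
      (S.pi fun j => D j).image fun g => S.attach.biUnion fun j => g j.1 j.2, ?_, ?_⟩
  · intro R hR
    simp only [mem_biUnion, mem_filter, mem_univ, true_and, mem_image] at hR
    obtain ⟨S, ⟨hSL, -⟩, g, hg, rfl⟩ := hR
    calc #(S.attach.biUnion fun j => g j.1 j.2) ≤ #S.attach * w :=
          card_biUnion_le_card_mul _ _ _ fun j _ => hD j.1 _ (mem_pi.1 hg j.1 j.2)
      _ ≤ L * w := by rw [card_attach]; exact Nat.mul_le_mul_right _ hSL
  · intro x
    constructor
    · rintro ⟨R, hR, hRx⟩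
      simp only [mem_biUnion, mem_filter, mem_univ, true_and, mem_image] at hR
      obtain ⟨S, ⟨-, hfS⟩, g, hg, rfl⟩ := hR
      refine eq_true_of_le_of_eq_true (hf fun j => ?_) hfS
      by_cases hj : j ∈ S
      · have hDj : EvalDNF (D j) x := ⟨g j hj, mem_pi.1 hg j hj, fun e he =>
          hRx e (mem_biUnion.2 ⟨⟨j, hj⟩, mem_attach _ _, he⟩)⟩
        rw [decide_eq_true hj, decide_eq_true hDj]
      · rw [decide_eq_false hj]
        exact Bool.false_le _
    · intro hfx
      obtain ⟨S, hSL, hSx, hfS⟩ := hcover _ hfx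
      have hSx' : ∀ j ∈ S, ∃ R ∈ D j, SatTerm R x := fun j hj => by
        simpa [EvalDNF] using hSx j hj
      choose g hgD hgx using hSx'
      refine ⟨S.attach.biUnion fun j => g j.1 j.2, ?_, ?_⟩
      · simp only [mem_biUnion, mem_filter, mem_univ, true_and, mem_image]
        exact ⟨S, ⟨hSL, hfS⟩, fun j hj => g j hj, mem_pi.2 hgD, rfl⟩
      · intro e he
        obtain ⟨j, -, he⟩ := mem_biUnion.1 he
        exact hgx j.1 j.2 e he

open Classical in
/-- **Width threshold** (registered stub `stub_narrowAlgebraic`). [cite: Jukna2012, Lemma 9.15] -/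
theorem stub_narrowAlgebraic : ∀ c : ℕ, ∃ r₀ s₀ : ℕ, 2 ≤ r₀ ∧ 2 ≤ s₀ ∧ ∀ r s : ℕ, r₀ ≤ r → s₀ ≤ s →
    ∀ᶠ m : ℕ in atTop, ∀ φ : GateFn,
      (IsPermGate ⌊(m : ℝ) ^ (1 / 16 : ℝ)⌋₊ φ ∨ IsGRankGate ⌊(m : ℝ) ^ (1 / 16 : ℝ)⌋₊ φ) →
      ∀ (D C : Fin φ.1 → Finset (Finset ((⊤ : SimpleGraph (Fin m)).edgeSet))),
        #(univ.image fun j => (D j, C j)) ≤ m ^ (c + 3) →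
        (∀ j, ∀ R ∈ D j, #R ≤ r - 1) → (∀ j, ∀ S ∈ C j, #S ≤ s - 1) →
        (∀ j x, EvalDNF (D j) x → EvalCNF (C j) x) →
        ∃ dnf cnf : Finset (Finset ((⊤ : SimpleGraph (Fin m)).edgeSet)),
          (∀ R ∈ dnf, #R ≤ r - 1) ∧ (∀ S ∈ cnf, #S ≤ s - 1) ∧
          (∀ x, EvalDNF dnf x → EvalCNF cnf x) ∧
          (#((posGraphs m ⌈(m : ℝ) ^ (1 / 4 : ℝ)⌉₊).filter
              (fun x => φ.2 (fun j => decide (EvalDNF (D j) x)) = true ∧ ¬ EvalDNF dnf x)) : ℝ)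
            ≤ (1 / (8 * (m : ℝ) ^ (c + 1))) * #(posGraphs m ⌈(m : ℝ) ^ (1 / 4 : ℝ)⌉₊) ∧
          (#((((powersetCard (Fintype.card ((⊤ : SimpleGraph (Fin m)).edgeSet) / ⌊(m : ℝ) ^ (1 / 8 : ℝ)⌋₊)
          (univ : Finset ((⊤ : SimpleGraph (Fin m)).edgeSet))).image (fun M => fun e => decide (e ∉ M)))).filter
              (fun x => EvalCNF cnf x ∧ φ.2 (fun j => decide (EvalCNF (C j) x)) = false)) : ℝ)
            ≤ (1 / (8 * (m : ℝ) ^ (c + 1))) *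
              #(((powersetCard (Fintype.card ((⊤ : SimpleGraph (Fin m)).edgeSet) / ⌊(m : ℝ) ^ (1 / 8 : ℝ)⌋₊)
          (univ : Finset ((⊤ : SimpleGraph (Fin m)).edgeSet))).image (fun M => fun e => decide (e ∉ M)))) := by
  intro c
  have hv2 : 1 ≤ (4 * (c + 3)).choose 2 := Nat.choose_pos (by omega)
  refine ⟨(4 * (c + 3)).choose 2 + 1, 16 * (c + 3), by omega, by omega, ?_⟩
  intro r s hr hs
  have hρ : 1 ≤ r - 1 := by omega
  filter_upwards [eventually_neg_numerics c (r - 1) s hs hρ, eventually_ge_atTop 17,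
    eventually_ge_atTop (8 * (s - 1) ^ r)] with m hneg hm17 hm8
  intro φ hφ D C _ hDw _ hDC
  -- the parameters `T = ⌊m^{1/16}⌋₊`, `D = ⌊m^{1/8}⌋₊`, `k = ⌈m^{1/4}⌉₊` and their sandwiches
  have hm1 : 1 ≤ m := by omega
  have hmT : m < (⌊(m : ℝ) ^ (1 / 16 : ℝ)⌋₊ + 1) ^ 16 :=
    lt_floor_rpow_add_one_pow m 16 (by norm_num)
  have hmD : m < (⌊(m : ℝ) ^ (1 / 8 : ℝ)⌋₊ + 1) ^ 8 := lt_floor_rpow_add_one_pow m 8 (by norm_num)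
  have hkm : m ≤ ⌈(m : ℝ) ^ (1 / 4 : ℝ)⌉₊ ^ 4 := le_ceil_rpow_pow m 4 (by norm_num)
  have hk1m : (⌈(m : ℝ) ^ (1 / 4 : ℝ)⌉₊ - 1) ^ 4 < m := ceil_rpow_sub_one_pow_lt hm1 4 (by norm_num)
  obtain ⟨hk2, hQ1, hpos⟩ := pos_numerics (c := c) hm17 hm8 hkm hk1m
  set T := ⌊(m : ℝ) ^ (1 / 16 : ℝ)⌋₊ with hT
  set Dd := ⌊(m : ℝ) ^ (1 / 8 : ℝ)⌋₊ with hDd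
  set k := ⌈(m : ℝ) ^ (1 / 4 : ℝ)⌉₊ with hk
  have hT1 : 1 ≤ T := by
    rcases Nat.eq_zero_or_pos T with h0 | h0
    · rw [h0] at hmT
      norm_num at hmT
      omega
    · exact h0
  have hD1 : 1 ≤ Dd := by
    rcases Nat.eq_zero_or_pos Dd with h0 | h0
    · rw [h0] at hmD
      norm_num at hmD
      omega
    · exact h0
  -- short minterms, the big DNF, two switchings
  obtain ⟨hmono, hcover⟩ := exists_minterm_of_perm_or_grank hφ
  obtain ⟨A₀, hA₀w, hA₀⟩ := exists_bigDNF φ.2 hmono (T * (Nat.log 2 T + 1)) (r - 1) hcover D hDw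
  set ℓ := T * (Nat.log 2 T + 1) * (r - 1) with hℓ
  have hℓpos : 0 < ℓ := Nat.mul_pos (Nat.mul_pos hT1 (Nat.succ_pos _)) hρ
  obtain ⟨B, Cf, hBw, hCfw, hCfcard, hA₀B, hBCf⟩ :=
    monotoneSwitching_dnf A₀ (ℓ + 1) s (fun R hR => by rw [Nat.add_sub_cancel]; exact hA₀w R hR)
  rw [Nat.add_sub_cancel] at hCfcard
  obtain ⟨A, Df, hAw, hDfw, hDfcard, hAB, hBA⟩ := monotoneSwitching_cnf B s r hBw
  refine ⟨A, B, hAw, hBw, hAB, ?_, ?_⟩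
  · -- POSITIVE SIDE: the error is covered by the exact `r`-monomials of `Df`
    apply cast_le_eps_mul hm1
    have hsub : (posGraphs m k).filter
        (fun x => φ.2 (fun j => decide (EvalDNF (D j) x)) = true ∧ ¬ EvalDNF A x) ⊆
        Df.biUnion fun R => (posGraphs m k).filter fun x => SatTerm R x := by
      intro x hx
      rw [Finset.mem_filter] at hx
      obtain ⟨hxP, hφx, hAx⟩ := hx
      rcases hBA x (hA₀B x ((hA₀ x).2 hφx)) with h | ⟨R, hR, hRx⟩
      · exact absurd h hAx
      · exact Finset.mem_biUnion.2 ⟨R, hR, Finset.mem_filter.2 ⟨hxP, hRx⟩⟩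
    have hstep := card_mul_le_of_subset_biUnion _ Df _ hsub fun R hR =>
      card_filter_pos_mul_pow_le hk2 hQ1 (Nat.mul_div_le m k) R
        (show (4 * (c + 3)).choose 2 < #R by rw [hDfw R hR]; omega) (fun x => SatTerm R x)
        (fun x hx => hx)
    refine Nat.le_of_mul_le_mul_right ?_ (Nat.pow_pos (n := r) (show 0 < s - 1 by omega))
    calc _ = _ := Nat.mul_assoc _ _ _
      _ ≤ _ := Nat.mul_le_mul_left _ hpos
      _ ≤ _ := hstep
      _ ≤ (s - 1) ^ r * #(posGraphs m k) := Nat.mul_le_mul_right _ hDfcard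
      _ = _ := Nat.mul_comm _ _
  · -- NEGATIVE SIDE: the error is covered by the exact `s`-clauses of `Cf`
    apply cast_le_eps_mul hm1
    have hsub : (((powersetCard (Fintype.card ((⊤ : SimpleGraph (Fin m)).edgeSet) / Dd)
        (univ : Finset ((⊤ : SimpleGraph (Fin m)).edgeSet))).image
          (fun M => fun e => decide (e ∉ M))).filter
          (fun x => EvalCNF B x ∧ φ.2 (fun j => decide (EvalCNF (C j) x)) = false)) ⊆
        Cf.biUnion fun S => (((powersetCard (Fintype.card ((⊤ : SimpleGraph (Fin m)).edgeSet) / Dd)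
          (univ : Finset ((⊤ : SimpleGraph (Fin m)).edgeSet))).image
            (fun M => fun e => decide (e ∉ M))).filter fun x => ¬ SatClause S x) := by
      intro x hx
      rw [Finset.mem_filter] at hx
      obtain ⟨hxN, hBx, hφx⟩ := hx
      have hnCf : ¬ EvalCNF Cf x := by
        intro hCfx
        have hle : (fun j => decide (EvalDNF (D j) x)) ≤ (fun j => decide (EvalCNF (C j) x)) := by
          intro j
          show decide (EvalDNF (D j) x) ≤ decide (EvalCNF (C j) x)
          by_cases hDj : EvalDNF (D j) x
          · rw [decide_eq_true hDj, decide_eq_true (hDC j x hDj)]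
          · rw [decide_eq_false hDj]
            exact Bool.false_le _
        have h2 := eq_true_of_le_of_eq_true (hmono hle) ((hA₀ x).1 (hBCf x hBx hCfx))
        rw [h2] at hφx
        exact Bool.noConfusion hφx
      obtain ⟨S, hS, hSx⟩ : ∃ S ∈ Cf, ¬ SatClause S x := by
        simpa [EvalCNF] using hnCf
      exact Finset.mem_biUnion.2 ⟨S, hS, Finset.mem_filter.2 ⟨hxN, hSx⟩⟩
    have hstep := card_mul_le_of_subset_biUnion _ Cf _ hsub (W := Dd ^ s) fun S hS => by
      rw [← hCfw S hS]
      exact card_filter_neg_mul_pow_le hD1 (Nat.div_mul_le_self _ _)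
        (fun M => fun e => decide (e ∉ M)) (fun M e => by simp) S _ (fun x hx => hx)
    refine Nat.le_of_mul_le_mul_right ?_ (Nat.pow_pos (n := s) hℓpos)
    calc _ = _ := Nat.mul_assoc _ _ _
      _ ≤ _ := Nat.mul_le_mul_left _ hneg
      _ ≤ _ := hstep
      _ ≤ ℓ ^ s * _ := Nat.mul_le_mul_right _ hCfcard
      _ = _ := Nat.mul_comm _ _

end Summit.PneNP.PneNP.Theorems.CliqueExtLowerBound.WidthThreshold.NarrowAlgebraic
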